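import Mathlib.Algebra.MonoidAlgebra.Support
import Mathlib.Algebra.FreeMonoid.Basic
import Mathlib.Algebra.BigOperators.Fin
import Mathlib.Algebra.Order.BigOperators.Group.Finset
import Summits.PneNP.PneNP.Theorems.CnfIdealGenLengthDefs
import Summits.PneNP.PneNP.Theorems.AperiodicTorusFregeHardGivesFregeNotPolyBounded
import HarnessLib

/-!
# `FregeShortensGenLength` (stmt-PneNP-18886) — Part A: word-degree and few-term calculus, translation lemmas

* `NCIPS.wordDeg` is invariant under negation, `wordDeg (p + q) ≤ max`, `wordDeg (p * q) ≤ wordDeg p + wordDeg q`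
  (lengths of words add);
* `Repr R E r f` (at most `r` single terms `u · g · v` of cofactor degree `≤ E`, see `CnfIdealGenLengthDefs`) is
  closed under `0`, axioms, sums, negation and — with the term count UNCHANGED — under multiplication on either
  side by cofactors of bounded word degree (cofactors are coefficient-blind: any number of monomials). This is
  what lets a dag-like Frege proof be simulated without tree-like blow-up (Part D); `hasBoundedRepr_of_repr`
  pads to exactly `r` terms;
* the translation `trForm`: substitution is composition, degree bounds, and the identity
  `trForm (stdLeaf R n) (¬ ofCNF φ) = clauseProduct R φ` — Frege's tautology `¬φ` IS the clause product;
  size and tautology bookkeeping for `¬ ofCNF φ` (the clause-size lemma `size_clauseFoldr_le` is reused from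
  `AperiodicTorusFregeHardGivesFregeNotPolyBounded`).
-/

set_option linter.dupNamespace false -- `Summit.PneNP.PneNP.…`: summit = sub-problem name (D-0017)

namespace Summit.PneNP.PneNP.Theorems.CnfIdealGenLength

open Literature.Computability.Complexity
open Literature.Computability.MetaComplexity
open Literature.Computability.MetaComplexity.NCIPS

noncomputable section

universe u v

variable {R : Type u} [CommRing R] {ν : Type v}

/-! ### Word degree calculus -/

/-- `wordDeg p ≤ D` iff every word in the support of `p` has length `≤ D`. [folklore] -/
theorem wordDeg_le_iff {p : MonoidAlgebra R (FreeMonoid ν)} {D : ℕ} :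
    wordDeg p ≤ D ↔ ∀ w ∈ p.coeff.support, FreeMonoid.length w ≤ D := by
  unfold wordDeg
  exact Finset.sup_le_iff

/-- The zero polynomial has word degree `0`. [folklore] -/
@[simp] theorem wordDeg_zero : wordDeg (0 : MonoidAlgebra R (FreeMonoid ν)) = 0 := by
  simp [wordDeg]

/-- Constants have word degree `0`; in particular `wordDeg 1 = 0`. [folklore] -/
@[simp] theorem wordDeg_one : wordDeg (1 : MonoidAlgebra R (FreeMonoid ν)) = 0 := by
  apply Nat.eq_zero_of_le_zero
  rw [wordDeg_le_iff]
  intro w hw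
  have h1 := MonoidAlgebra.support_coeff_one_subset (k := R) (G := FreeMonoid ν) hw
  rw [Finset.mem_one] at h1
  simp [h1]

/-- The letter `x_i` has word degree `≤ 1`. [folklore] -/
theorem wordDeg_X_le (i : ν) : wordDeg (X R i) ≤ 1 := by
  rw [wordDeg_le_iff]
  intro w hw
  unfold X at hw
  rw [MonoidAlgebra.of_apply, MonoidAlgebra.coeff_single] at hw
  have h1 := Finsupp.support_single_subset hw
  rw [Finset.mem_singleton] at h1
  simp [h1]

/-- Word degree of a sum. [folklore] -/
theorem wordDeg_add_le (p q : MonoidAlgebra R (FreeMonoid ν)) :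
    wordDeg (p + q) ≤ max (wordDeg p) (wordDeg q) := by
  classical
  rw [wordDeg_le_iff]
  intro w hw
  rw [MonoidAlgebra.coeff_add] at hw
  rcases Finset.mem_union.1 (Finsupp.support_add hw) with h | h
  · exact (Finset.le_sup (f := FreeMonoid.length) h).trans (le_max_left _ _)
  · exact (Finset.le_sup (f := FreeMonoid.length) h).trans (le_max_right _ _)

/-- Word degree of a sum, bound form. [folklore] -/
theorem wordDeg_add_le_of_le {p q : MonoidAlgebra R (FreeMonoid ν)} {D : ℕ} (hp : wordDeg p ≤ D)
    (hq : wordDeg q ≤ D) : wordDeg (p + q) ≤ D :=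
  (wordDeg_add_le p q).trans (max_le hp hq)

/-- Word degree is invariant under negation. [folklore] -/
@[simp] theorem wordDeg_neg (p : MonoidAlgebra R (FreeMonoid ν)) : wordDeg (-p) = wordDeg p := by
  unfold wordDeg
  rw [MonoidAlgebra.coeff_neg, Finsupp.support_neg]

/-- Word degree of a difference, bound form. [folklore] -/
theorem wordDeg_sub_le_of_le {p q : MonoidAlgebra R (FreeMonoid ν)} {D : ℕ} (hp : wordDeg p ≤ D)
    (hq : wordDeg q ≤ D) : wordDeg (p - q) ≤ D := by
  rw [sub_eq_add_neg]
  exact wordDeg_add_le_of_le hp (by rwa [wordDeg_neg])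

/-- `wordDeg (1 - p) ≤ D` whenever `wordDeg p ≤ D`. [folklore] -/
theorem wordDeg_one_sub_le {p : MonoidAlgebra R (FreeMonoid ν)} {D : ℕ} (hp : wordDeg p ≤ D) :
    wordDeg (1 - p) ≤ D :=
  wordDeg_sub_le_of_le (by simp) hp

/-- Word degree of a product: lengths of words add. [folklore] -/
theorem wordDeg_mul_le (p q : MonoidAlgebra R (FreeMonoid ν)) :
    wordDeg (p * q) ≤ wordDeg p + wordDeg q := by
  classical
  rw [wordDeg_le_iff]
  intro w hw
  have h := MonoidAlgebra.support_coeff_mul_subset p q hw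
  obtain ⟨a, ha, b, hb, rfl⟩ := Finset.mem_mul.1 h
  rw [FreeMonoid.length_mul]
  exact Nat.add_le_add (Finset.le_sup (f := FreeMonoid.length) ha)
    (Finset.le_sup (f := FreeMonoid.length) hb)

/-- Word degree of a product, bound form. [folklore] -/
theorem wordDeg_mul_le_of_le {p q : MonoidAlgebra R (FreeMonoid ν)} {D D' : ℕ} (hp : wordDeg p ≤ D)
    (hq : wordDeg q ≤ D') : wordDeg (p * q) ≤ D + D' :=
  (wordDeg_mul_le p q).trans (Nat.add_le_add hp hq)

namespace Repr

variable {E E' r r' D : ℕ} {f f' : MonoidAlgebra R (FreeMonoid ν)}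

/-- Monotonicity in both parameters. [folklore] -/
theorem mono (h : Repr R E r f) (hE : E ≤ E') (hr : r ≤ r') : Repr R E' r' f := by
  obtain ⟨m, hm, u, g, v, huv, hsum⟩ := h
  exact ⟨m, hm.trans hr, u, g, v, fun ρ => ⟨(huv ρ).1, (huv ρ).2.1.trans hE, (huv ρ).2.2.trans hE⟩,
    hsum⟩

/-- Transport along an equality. [folklore] -/
theorem congr (h : Repr R E r f) (hf : f = f') : Repr R E r f' := hf ▸ h

/-- `0` needs no terms. [folklore] -/
theorem zero : Repr R E r (0 : MonoidAlgebra R (FreeMonoid ν)) :=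
  ⟨0, Nat.zero_le _, Fin.elim0, Fin.elim0, Fin.elim0, fun ρ => ρ.elim0, by simp⟩

/-- An axiom is one term with constant cofactors. [folklore] -/
theorem of_isAxiom {g : MonoidAlgebra R (FreeMonoid ν)} (hg : IsAxiom g) (hr : 1 ≤ r) : Repr R E r g :=
  ⟨1, hr, fun _ => 1, fun _ => g, fun _ => 1, fun _ => ⟨hg, by simp, by simp⟩, by simp⟩

/-- Sums: term counts add. [folklore] -/
theorem add (h : Repr R E r f) (h' : Repr R E r' f') : Repr R E (r + r') (f + f') := by
  obtain ⟨m, hm, u, g, v, huv, hsum⟩ := h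
  obtain ⟨m', hm', u', g', v', huv', hsum'⟩ := h'
  refine ⟨m + m', Nat.add_le_add hm hm', Fin.append u u', Fin.append g g', Fin.append v v', ?_, ?_⟩
  · intro ρ
    refine Fin.addCases (fun i => ?_) (fun i => ?_) ρ
    · simpa only [Fin.append_left] using huv i
    · simpa only [Fin.append_right] using huv' i
  · rw [Fin.sum_univ_add]
    simp only [Fin.append_left, Fin.append_right, hsum, hsum']

/-- Negation: negate the left cofactors. [folklore] -/
theorem neg (h : Repr R E r f) : Repr R E r (-f) := by
  obtain ⟨m, hm, u, g, v, huv, hsum⟩ := h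
  refine ⟨m, hm, fun ρ => -u ρ, g, v, fun ρ => ⟨(huv ρ).1, by simpa using (huv ρ).2.1, (huv ρ).2.2⟩,
    ?_⟩
  simp only [neg_mul, Finset.sum_neg_distrib, hsum]

/-- Differences. [folklore] -/
theorem sub (h : Repr R E r f) (h' : Repr R E r' f') : Repr R E (r + r') (f - f') := by
  rw [sub_eq_add_neg]; exact h.add h'.neg

/-- Left multiplication by a cofactor of word degree `≤ D` keeps the number of terms and raises the
cofactor degree by `D` (the cofactor `a` may have any number of monomials). [folklore] -/
theorem mul_left (h : Repr R E r f) {a : MonoidAlgebra R (FreeMonoid ν)} (ha : wordDeg a ≤ D) :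
    Repr R (D + E) r (a * f) := by
  obtain ⟨m, hm, u, g, v, huv, hsum⟩ := h
  refine ⟨m, hm, fun ρ => a * u ρ, g, v, fun ρ => ⟨(huv ρ).1, wordDeg_mul_le_of_le ha (huv ρ).2.1,
    (huv ρ).2.2.trans (Nat.le_add_left _ _)⟩, ?_⟩
  rw [← hsum, Finset.mul_sum]
  simp only [mul_assoc]

/-- Right multiplication by a cofactor of word degree `≤ D`. [folklore] -/
theorem mul_right (h : Repr R E r f) {b : MonoidAlgebra R (FreeMonoid ν)} (hb : wordDeg b ≤ D) :
    Repr R (E + D) r (f * b) := by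
  obtain ⟨m, hm, u, g, v, huv, hsum⟩ := h
  refine ⟨m, hm, u, g, fun ρ => v ρ * b, fun ρ => ⟨(huv ρ).1, (huv ρ).2.1.trans (Nat.le_add_right _ _),
    wordDeg_mul_le_of_le (huv ρ).2.2 hb⟩, ?_⟩
  rw [← hsum, Finset.sum_mul]
  simp only [mul_assoc]

end Repr

/-- Padding with zero terms: an at-most-`r`-term representation of `clauseProduct R φ` (`φ` a CNF over
`Fin n`, `0 < n` so that the Boolean axiom of `x_0` is available as a dummy) is a `HasBoundedRepr R E R' φ`
for every `R' ≥ r`. [cite: LiTzameretWang2018, Def. 1.2] -/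
theorem hasBoundedRepr_of_repr {n : ℕ} (hn : 0 < n) {E r R' : ℕ} {φ : CNF (Fin n)}
    (h : Repr R E r (clauseProduct R φ)) (hR : r ≤ R') : HasBoundedRepr R E R' φ := by
  obtain ⟨m, hm, u, g, v, huv, hsum⟩ := h
  obtain ⟨d, rfl⟩ := Nat.exists_eq_add_of_le (hm.trans hR)
  have hax : IsAxiom (X R (⟨0, hn⟩ : Fin n) * X R (⟨0, hn⟩ : Fin n) - X R (⟨0, hn⟩ : Fin n)) :=
    Or.inl ⟨_, rfl⟩
  refine ⟨Fin.append u (fun _ => 0),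
    Fin.append g (fun _ => X R (⟨0, hn⟩ : Fin n) * X R ⟨0, hn⟩ - X R ⟨0, hn⟩),
    Fin.append v (fun _ => 0), ?_, ?_⟩
  · intro ρ
    refine Fin.addCases (fun i => ?_) (fun i => ?_) ρ
    · simpa only [Fin.append_left] using huv i
    · simp only [Fin.append_right, wordDeg_zero, Nat.zero_le, and_true]
      exact hax
  · rw [Fin.sum_univ_add]
    simp only [Fin.append_left, Fin.append_right, hsum, zero_mul, Finset.sum_const_zero, add_zero]

section trForm

variable (w : ℕ → MonoidAlgebra R (FreeMonoid ν))

/-- Substitution is composition: `tr_w (B[σ]) = tr_{i ↦ tr_w (σ i)} (B)`. [cite: LiTzameretWang2018, Def. 1.3] -/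
theorem trForm_subst (σ : ℕ → PropForm ℕ) (B : PropForm ℕ) :
    trForm w (B.subst σ) = trForm (fun i => trForm w (σ i)) B := by
  induction B with
  | var i => rfl
  | const b => cases b <;> rfl
  | neg B ih => simp [PropForm.subst, ih]
  | conj B C ihB ihC => simp [PropForm.subst, ihB, ihC]
  | disj B C ihB ihC => simp [PropForm.subst, ihB, ihC]

/-- Degree bound: if every leaf has word degree `≤ s` then `wordDeg (tr B) ≤ size(B) · s`.
[cite: LiTzameretWang2018, Def. 1.3] -/
theorem wordDeg_trForm_le {s : ℕ} (B : PropForm ℕ) (h : ∀ i ∈ B.vars, wordDeg (w i) ≤ s) :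
    wordDeg (trForm w B) ≤ B.size * s := by
  induction B with
  | var i => simpa [PropForm.size] using h i (by simp [PropForm.vars])
  | const b => cases b <;> simp
  | neg B ih =>
    simp only [trForm_neg, PropForm.size]
    exact (wordDeg_one_sub_le (ih h)).trans (Nat.mul_le_mul_right _ (Nat.le_succ _))
  | conj B C ihB ihC =>
    simp only [trForm_conj, PropForm.size]
    have hB := ihB fun i hi => h i (by simp [PropForm.vars, hi])
    have hC := ihC fun i hi => h i (by simp [PropForm.vars, hi])
    refine (wordDeg_one_sub_le (wordDeg_mul_le_of_le (wordDeg_one_sub_le hB)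
      (wordDeg_one_sub_le hC))).trans ?_
    rw [Nat.add_mul, Nat.add_mul]; omega
  | disj B C ihB ihC =>
    simp only [trForm_disj, PropForm.size]
    have hB := ihB fun i hi => h i (by simp [PropForm.vars, hi])
    have hC := ihC fun i hi => h i (by simp [PropForm.vars, hi])
    refine (wordDeg_mul_le_of_le hB hC).trans ?_
    rw [Nat.add_mul, Nat.add_mul]; omega

end trForm

section leaf

variable (w : ℕ → MonoidAlgebra R (FreeMonoid ν))

/-- The two literal factors of a variable sum to `1`. [folklore] -/
theorem leafLit_false_add_true (i : ℕ) : leafLit w (i, false) + leafLit w (i, true) = 1 := by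
  simp [leafLit]

/-- Degree of a literal factor. [folklore] -/
theorem wordDeg_leafLit_le {s : ℕ} (l : ℕ × Bool) (h : wordDeg (w l.1) ≤ s) : wordDeg (leafLit w l) ≤ s := by
  unfold leafLit
  split_ifs
  · exact wordDeg_one_sub_le h
  · exact h

/-- Degree of a point indicator: `≤ length × s`. [folklore] -/
theorem wordDeg_leafProd_le {s : ℕ} (ρ : List (ℕ × Bool)) (h : ∀ l ∈ ρ, wordDeg (w l.1) ≤ s) :
    wordDeg (leafProd w ρ) ≤ ρ.length * s := by
  induction ρ with
  | nil => simp
  | cons l ρ ih =>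
    rw [leafProd_cons, List.length_cons, Nat.succ_mul]
    exact wordDeg_mul_le_of_le (ih fun l' hl' => h l' (by simp [hl'])) (wordDeg_leafLit_le w l (h l (by simp)))

end leaf

/-- The standard leaves have word degree `≤ 1`. [folklore] -/
theorem wordDeg_stdLeaf_le {n : ℕ} (i : ℕ) : wordDeg (stdLeaf R n i) ≤ 1 := by
  unfold stdLeaf
  split_ifs
  · exact wordDeg_one_sub_le (wordDeg_X_le _)
  · simp

/-- Hence `wordDeg (tr B) ≤ size B` for the standard translation. [cite: LiTzameretWang2018, Def. 1.3] -/
theorem wordDeg_trForm_stdLeaf_le {n : ℕ} (B : PropForm ℕ) : wordDeg (trForm (stdLeaf R n) B) ≤ B.size := by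
  simpa using wordDeg_trForm_le (stdLeaf R n) (s := 1) B fun i _ => wordDeg_stdLeaf_le i

/-- The translation of the clause formula is the clause word: `tr(l₁ ∨ … ∨ l_w ∨ ⊥) = Q_κ`.
[cite: LiTzameretWang2018, Def. 1.6] -/
theorem trForm_clauseForm {n : ℕ} (κ : Clause (Fin n)) :
    trForm (stdLeaf R n) ((κ.map fun l => (l.1.val, l.2)).foldr
      (fun l d => PropForm.disj (if l.2 then PropForm.var l.1 else PropForm.neg (PropForm.var l.1)) d)
      (PropForm.const false)) = clauseWord R κ := by
  induction κ with
  | nil => simp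
  | cons l κ ih =>
    rw [List.map_cons, List.foldr_cons, trForm_disj, ih, clauseWord_cons]
    congr 1
    rcases l with ⟨i, b⟩
    cases b <;> simp [litWord, stdLeaf_of_lt]

/-- **The tautology `¬φ` translates to the clause product:** reading the CNF `φ` over `Fin n` as one over `ℕ`
(variable `i ↦ i.val`), `tr(¬ ofCNF φ) = clauseProduct R φ` (`P_φ = ∏_κ (1 - Q_κ)`), on the nose, for the
standard leaves. [cite: LiTzameretWang2018, Def. 1.3 with Def. 1.6] -/
theorem trForm_neg_ofCNF {n : ℕ} (φ : CNF (Fin n)) :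
    trForm (stdLeaf R n) (PropForm.neg (PropForm.ofCNF (φ.map fun κ => κ.map fun l => (l.1.val, l.2)))) =
      clauseProduct R φ := by
  rw [trForm_neg]
  induction φ with
  | nil => simp [PropForm.ofCNF]
  | cons κ φ ih =>
    have h1 : PropForm.ofCNF ((κ :: φ).map fun κ => κ.map fun l => (l.1.val, l.2)) =
        PropForm.conj ((κ.map fun l => (l.1.val, l.2)).foldr
          (fun l d => PropForm.disj (if l.2 then PropForm.var l.1 else PropForm.neg (PropForm.var l.1)) d)
          (PropForm.const false)) (PropForm.ofCNF (φ.map fun κ => κ.map fun l => (l.1.val, l.2))) := by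
      simp [PropForm.ofCNF]
    rw [h1, trForm_conj, sub_sub_cancel, ih, trForm_clauseForm, clauseProduct_cons]

/-! ### Bookkeeping for the tautology `¬ ofCNF φ` -/

/-- Reading a CNF over `Fin n` as one over `ℕ` preserves the number of clauses. [folklore] -/
theorem numClauses_map_val {n : ℕ} (φ : CNF (Fin n)) :
    CNF.numClauses (φ.map fun κ => κ.map fun l => (l.1.val, l.2)) = φ.numClauses := by
  simp [CNF.numClauses]

/-- Reading a CNF over `Fin n` as one over `ℕ` preserves the size. [folklore] -/
theorem size_map_val {n : ℕ} (φ : CNF (Fin n)) :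
    CNF.size (φ.map fun κ => κ.map fun l => (l.1.val, l.2)) = φ.size := by
  simp [CNF.size, Function.comp_def]

/-- Reading a CNF over `Fin n` as one over `ℕ` preserves evaluation along `Fin.val`. [folklore] -/
theorem eval_map_val {n : ℕ} (φ : CNF (Fin n)) (σ : ℕ → Bool) :
    CNF.eval (φ.map fun κ => κ.map fun l => (l.1.val, l.2)) σ = φ.eval (fun i => σ i.val) := by
  induction φ with
  | nil => rfl
  | cons κ φ ih =>
    have hκ : Clause.eval σ (κ.map fun l => (l.1.val, l.2)) = Clause.eval (fun i : Fin n => σ i.val) κ := by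
      induction κ with
      | nil => rfl
      | cons l κ ihκ =>
        simp only [Clause.eval, List.map_cons, List.any_cons] at ihκ ⊢
        rw [ihκ]
        rfl
    simp only [List.map_cons, CNF.eval_cons] at ih ⊢
    rw [ih, hκ]

/-- An unsatisfiable CNF over `Fin n` stays unsatisfiable over `ℕ`, so `¬ ofCNF` of it is a tautology.
[folklore] -/
theorem isTautology_neg_ofCNF {n : ℕ} {φ : CNF (Fin n)} (h : ¬ φ.Satisfiable) :
    (PropForm.neg (PropForm.ofCNF (φ.map fun κ => κ.map fun l => (l.1.val, l.2)))).IsTautology := by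
  intro σ
  have h' : φ.eval (fun i => σ i.val) ≠ true := fun hσ => h ⟨_, hσ⟩
  simp only [PropForm.eval, PropForm.eval_ofCNF, eval_map_val, Bool.not_eq_true']
  simpa using h'

/-- Size of `ofCNF φ`: at most `3 · size φ + 2 · numClauses φ + 1`. [folklore] -/
theorem size_ofCNF_le (φ : CNF ℕ) : (PropForm.ofCNF φ).size ≤ 3 * φ.size + 2 * φ.numClauses + 1 := by
  induction φ with
  | nil => simp [PropForm.ofCNF, PropForm.size]
  | cons c φ ih =>
    have hc := size_clauseFoldr_le c
    simp only [PropForm.ofCNF, List.foldr_cons, PropForm.size, CNF.size, CNF.numClauses, List.map_cons,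
      List.sum_cons, List.length_cons] at ih hc ⊢
    omega

end

end Summit.PneNP.PneNP.Theorems.CnfIdealGenLength
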